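import Summits.BirchSwinnertonDyer.BirchSwinnertonDyer.Theorems.UniversalToricDescentAcDualMuZeroCriterion
import Literature.NumberTheory.EllipticCurves.KellerYin2024.MultiplicativeImprimitiveMuInvariant
import HarnessLib

/-!
# Keller–Yin Lemma 5.1.1 at `p ‖ N` ⟺ a RESIDUAL FINITENESS statement: the named preprint fact
# `KellerYin2024.lemma511_…_OPEN` («`𝔛^S_f` is `Λ`-torsion with `μ = 0`») is EQUIVALENT, in the
# kernel, to «`Sel_𝔭̄^{Sf}(K_∞, E_K[p^∞])[p]` is finite» at the same data (cell `bsd-eis`, seat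
# `bsd-line-x2-p2` gen 3, D-0154 KEY row 5; crux 4 `BSDpOnCellC` line b1 v11, stub `stub_muSelmer` /
# v12-draft `stub_lemma511`; companions p621903, p622336)

HONEST FRAMING (cell `bsd-eis`, run/shared/lean/pub/bsd-eis/): tool theorems (no definition, no new
named fact, no `sorry`); the two theorems with `_OPEN` in a hypothesis are CONDITIONAL on the unrefereed
claim by name; nothing about any curve is asserted; nothing booked; no label or count moves; BSD and the
main conjectures are proved for NO curve. Helper `--supports stmt-BirchSwinnertonDyer-19034`; closes no
registered stub.

## Why

Line b1's `μ`-input is now the NAMED preprint fact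
`KellerYin2024.lemma511_imprimitive_isTorsion_muInvariant_eq_zero_mult_OPEN` (p621903; Keller–Yin
arXiv:2402.12781v2 §5.1 Lemma 5.1.1, member-`f` half): at an odd Eisenstein `p ‖ N`, for `Sf` = the
places of `K` over `N_E` off `p`, `X^{Sf} = AcSelmer.XAc (E_K) p κ v̄ ↑Sf γ` is `Λ`-torsion with `μ = 0`.
Its printed proof ("essentially proved in Thm. 1.4.1 since the proof only relies on the extension
`0 → 𝔽(φ) → ρ̄_f → 𝔽(ψ) → 0`") is the Greenberg–Vatsal devissage, whose OUTPUT is a finiteness statement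
about `p`-torsion classes. The tree already holds Greenberg's criterion (A) for Castella's object in
both directions (`UniversalToricDescentAcDualMuZero.{isTorsion,muInvariant_eq_zero}_of_finite_pTorsion`,
`finite_pTorsion_of_muInvariant_eq_zero`; Greenberg LNM 1716 §1 p. 60, Greenberg–Vatsal Prop. (2.8),
Washington §13.2). Hence the named fact is EQUIVALENT to the residual statement
«`{s ∈ Sel_v̄^{Sf}(K_∞, E_K[p^∞]) : p·s = 0}` is finite» at the same binders — the currency in which a
future kernel devissage (`H¹(K_∞, 𝔽(φ)) → H¹(K_∞, E[p]) → H¹(K_∞, 𝔽(ψ))` with the `Sf`-imprimitive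
local conditions, finiteness of the outer terms from Rubin–Hida `μ = 0`) would discharge it:

* §1 `lemma511_OPEN_of_residualFinite` — «∀ data, `Sel^{Sf}[p]` finite» ⟹ the named fact.
* §2 `residualFinite_of_lemma511_OPEN` — the named fact ⟹ «∀ data, `Sel^{Sf}[p]` finite».
* §3 `lemma511_OPEN_iff_residualFinite` — the equivalence; and `stubMuSelmerInput_of_residualFinite`:
  at ONE datum, `Sel^{Sf}[p]` finite ⟹ `X^∅` torsion with `μ(X^∅) = 0` (what v11's `stub_muSelmer`
  consumes, via p622336's `isTorsion_muInvariant_eq_zero_empty_of_imprimitive`-shape bookkeeping: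
  here directly from criterion (A) at `Sf` and at `∅`, since `Sel^∅[p] ⊆ Sel^{Sf}[p]`).

What this is NOT: not a proof of either side; the devissage itself is not in the tree.

References: [KellerYin2024] Lemma 5.1.1 (TeX L1744–1749), Thm. 1.4.1 (L1087–1098); [GreenbergLNM1716]
§1 p. 60; [GreenbergVatsal2000] §2 Prop. (2.8); [Washington1997] §13.2; [Castella2018] Def. 2.2;
[LimSujatha2018] §3; cell: p621903, p622336, v11 (aa11a952…), v12 draft (155e218d…).
-/

set_option autoImplicit false
set_option linter.dupNamespace false -- the summit namespace `…BirchSwinnertonDyer.BirchSwinnertonDyer.Theorems` (Sub = Summit, D-0017) trips it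

noncomputable section

open scoped Classical

open WeierstrassCurve NumberField IsDedekindDomain Field
  Literature.NumberTheory.EllipticCurves Literature.NumberTheory.EllipticCurves.IwasawaAlgebra
  Literature.NumberTheory.QuadraticFields Literature.NumberTheory.EllipticCurves.Rank1Residual
  Literature.NumberTheory.GaloisRepresentations
  Summit.BirchSwinnertonDyer.Rank1Residual.X11b Summit.BirchSwinnertonDyer.Rank1Residual.X11b.AcSelmer
  Summit.BirchSwinnertonDyer.BirchSwinnertonDyer.Theorems
open Literature.NumberTheory.EllipticCurves.KellerYin2024
  (lemma511_imprimitive_isTorsion_muInvariant_eq_zero_mult_OPEN)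

namespace Summit.BirchSwinnertonDyer.BirchSwinnertonDyer.Theorems.KellerYinLemma511ResidualFinite

/-! ### §1 Residual finiteness ⟹ the named fact -/

/-- **«`Sel_v̄^{Sf}(K_∞, E_K[p^∞])[p]` finite at every datum of Lemma 5.1.1» ⟹
`KellerYin2024.lemma511_imprimitive_isTorsion_muInvariant_eq_zero_mult_OPEN`.** The hypothesis carries
the binders of the named fact VERBATIM (`2 < p`, `Mult`, `Red`; `K` imaginary quadratic with (Heeg) for
`N_E`, `d_K` odd `≠ −3`, `(p)` split; `v̄ ∋ p`; `κ` anticyclotomic with topological generator `γ`; `Sf` =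
places over `N_E` off `p`) and concludes the finiteness of the `p`-torsion of Castella's `Sf`-imprimitive
Selmer group (the tree's `Summits` twin `X11b.AcSelmer.selmerAc`, definitionally Castella's); Greenberg's
criterion (A) (`UniversalToricDescentAcDualMuZero.isTorsion_of_finite_pTorsion`,
`muInvariant_eq_zero_of_finite_pTorsion`) turns it into torsion + `μ = 0` of the dual. Unconditional
implication; nothing asserted about any curve. [cite: GreenbergLNM1716, §1 p. 60 (after Conj. 1.3)]
[cite: GreenbergVatsal2000, §2 Prop. (2.8)] [cite: KellerYin2024, Lemma 5.1.1 (arXiv:2402.12781v2 §5.1 TeX L1744–1749)] -/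
theorem lemma511_OPEN_of_residualFinite
    (h : ∀ {p : ℕ} [Fact p.Prime] (W : WeierstrassCurve ℚ) [W.IsElliptic] [W.IsGloballyMinimal]
      (K : Type) [Field K] [NumberField K] (vbar : HeightOneSpectrum (𝓞 K))
      (κ : ZpExtension K p) (γ : absoluteGaloisGroup K) [Fact (κ.IsTopGenerator γ)]
      (Sf : Finset (HeightOneSpectrum (𝓞 K))),
      2 < p → Mult W p → Red W p →
      IsImaginaryQuadratic K → SatisfiesHeegnerHypothesis (W.conductorNorm ℤ) K →
        Odd (NumberField.discr K) → NumberField.discr K ≠ -3 →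
        ((Ideal.span {(p : ℤ)}).primesOver (𝓞 K)).ncard = 2 →
      ((p : ℕ) : 𝓞 K) ∈ vbar.asIdeal → κ.IsAnticyclotomic →
      (∀ w : HeightOneSpectrum (𝓞 K), w ∈ Sf ↔
        (((W.conductorNorm ℤ : ℤ) : 𝓞 K) ∈ w.asIdeal ∧ ((p : ℕ) : 𝓞 K) ∉ w.asIdeal)) →
      Set.Finite {s : selmerAc (W.baseChange K) p κ vbar (↑Sf : Set (HeightOneSpectrum (𝓞 K))) |
        p • s = 0}) :
    lemma511_imprimitive_isTorsion_muInvariant_eq_zero_mult_OPEN := by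
  unfold lemma511_imprimitive_isTorsion_muInvariant_eq_zero_mult_OPEN
  intro p _ W _ _ K _ _ vbar κ γ _ Sf hp hmult hred hK hH hodd h3 hsplit hvbar hκ hSf
  haveI : (W.baseChange K).IsElliptic := by rw [WeierstrassCurve.baseChange]; infer_instance
  have hS : (↑Sf : Set (HeightOneSpectrum (𝓞 K))).Finite := Finset.finite_toSet Sf
  have hfin := h W K vbar κ γ Sf hp hmult hred hK hH hodd h3 hsplit hvbar hκ hSf
  exact ⟨UniversalToricDescentAcDualMuZero.isTorsion_of_finite_pTorsion (W.baseChange K) p κ vbar _ γ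
      hS hfin,
    UniversalToricDescentAcDualMuZero.muInvariant_eq_zero_of_finite_pTorsion (W.baseChange K) p κ vbar _
      γ hS hfin⟩

/-! ### §2 The named fact ⟹ residual finiteness -/

/-- **`KellerYin2024.lemma511_…_OPEN` ⟹ «`Sel_v̄^{Sf}(K_∞, E_K[p^∞])[p]` finite at every datum»**
(the converse bookkeeping: a finitely generated torsion `Λ`-module with `μ = 0` is finitely generated over
`ℤ_p`, Washington §13.2, and then its Pontryagin partner has finite `p`-torsion, Lim–Sujatha §3;
tree `UniversalToricDescentAcDualMuZero.finite_pTorsion_of_muInvariant_eq_zero` with Castella's finite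
generation `XAc.module_finite`). CONDITIONAL on the OPEN fact; nothing asserted.
[claim: KellerYin2024, status: under-review]
[cite: KellerYin2024, Lemma 5.1.1 (arXiv:2402.12781v2 §5.1 TeX L1744–1749)]
[cite: Washington1997, §13.2] [cite: LimSujatha2018, §3 (before Prop. 3.2)] -/
theorem residualFinite_of_lemma511_OPEN
    (h511 : lemma511_imprimitive_isTorsion_muInvariant_eq_zero_mult_OPEN)
    {p : ℕ} [Fact p.Prime] (W : WeierstrassCurve ℚ) [W.IsElliptic] [W.IsGloballyMinimal]
    (K : Type) [Field K] [NumberField K] (vbar : HeightOneSpectrum (𝓞 K))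
    (κ : ZpExtension K p) (γ : absoluteGaloisGroup K) [Fact (κ.IsTopGenerator γ)]
    (Sf : Finset (HeightOneSpectrum (𝓞 K)))
    (hp : 2 < p) (hmult : Mult W p) (hred : Red W p) (hK : IsImaginaryQuadratic K)
    (hH : SatisfiesHeegnerHypothesis (W.conductorNorm ℤ) K) (hodd : Odd (NumberField.discr K))
    (h3 : NumberField.discr K ≠ -3) (hsplit : ((Ideal.span {(p : ℤ)}).primesOver (𝓞 K)).ncard = 2)
    (hvbar : ((p : ℕ) : 𝓞 K) ∈ vbar.asIdeal) (hκ : κ.IsAnticyclotomic)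
    (hSf : ∀ w : HeightOneSpectrum (𝓞 K), w ∈ Sf ↔
      (((W.conductorNorm ℤ : ℤ) : 𝓞 K) ∈ w.asIdeal ∧ ((p : ℕ) : 𝓞 K) ∉ w.asIdeal)) :
    Set.Finite {s : selmerAc (W.baseChange K) p κ vbar (↑Sf : Set (HeightOneSpectrum (𝓞 K))) |
      p • s = 0} := by
  haveI : (W.baseChange K).IsElliptic := by rw [WeierstrassCurve.baseChange]; infer_instance
  haveI : Module.Finite (IwasawaAlgebra p)
      (XAc (W.baseChange K) p κ vbar (↑Sf : Set (HeightOneSpectrum (𝓞 K))) γ) :=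
    XAc.module_finite κ vbar _ γ (Finset.finite_toSet Sf)
  obtain ⟨htor, hμ⟩ := h511 W K vbar κ γ Sf hp hmult hred hK hH hodd h3 hsplit hvbar hκ hSf
  exact UniversalToricDescentAcDualMuZero.finite_pTorsion_of_muInvariant_eq_zero (W.baseChange K) p κ vbar
    _ γ htor hμ

/-! ### §3 The equivalence, and the one-datum form v11's `stub_muSelmer` consumes -/

/-- **Keller–Yin Lemma 5.1.1 (member `f`, as typed) ⟺ residual finiteness**:
`lemma511_…_OPEN ↔ ∀ data, Sel_v̄^{Sf}(K_∞, E_K[p^∞])[p]` finite. Kernel equivalence (criterion (A) both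
ways); neither side is asserted. [cite: GreenbergLNM1716, §1 p. 60] [cite: GreenbergVatsal2000, §2 Prop. (2.8)]
[cite: KellerYin2024, Lemma 5.1.1 (arXiv:2402.12781v2 §5.1 TeX L1744–1749)] -/
theorem lemma511_OPEN_iff_residualFinite :
    lemma511_imprimitive_isTorsion_muInvariant_eq_zero_mult_OPEN ↔
    ∀ {p : ℕ} [Fact p.Prime] (W : WeierstrassCurve ℚ) [W.IsElliptic] [W.IsGloballyMinimal]
      (K : Type) [Field K] [NumberField K] (vbar : HeightOneSpectrum (𝓞 K))
      (κ : ZpExtension K p) (γ : absoluteGaloisGroup K) [Fact (κ.IsTopGenerator γ)]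
      (Sf : Finset (HeightOneSpectrum (𝓞 K))),
      2 < p → Mult W p → Red W p →
      IsImaginaryQuadratic K → SatisfiesHeegnerHypothesis (W.conductorNorm ℤ) K →
        Odd (NumberField.discr K) → NumberField.discr K ≠ -3 →
        ((Ideal.span {(p : ℤ)}).primesOver (𝓞 K)).ncard = 2 →
      ((p : ℕ) : 𝓞 K) ∈ vbar.asIdeal → κ.IsAnticyclotomic →
      (∀ w : HeightOneSpectrum (𝓞 K), w ∈ Sf ↔
        (((W.conductorNorm ℤ : ℤ) : 𝓞 K) ∈ w.asIdeal ∧ ((p : ℕ) : 𝓞 K) ∉ w.asIdeal)) →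
      Set.Finite {s : selmerAc (W.baseChange K) p κ vbar (↑Sf : Set (HeightOneSpectrum (𝓞 K))) |
        p • s = 0} :=
  ⟨fun h511 _ _ W _ _ K _ _ vbar κ γ _ Sf hp hmult hred hK hH hodd h3 hsplit hvbar hκ hSf ↦
      residualFinite_of_lemma511_OPEN h511 W K vbar κ γ Sf hp hmult hred hK hH hodd h3 hsplit hvbar hκ hSf,
    fun h ↦ lemma511_OPEN_of_residualFinite h⟩

/-- **One datum: `Sel_𝔭^{S}(K_∞, E[p^∞])[p]` finite ⟹ the PRIMITIVE dual `X^∅` is `Λ`-torsion with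
`μ(X^∅) = 0`** (any elliptic `W/K`, any `𝔭`, any finite `S`): `Sel^∅ ≤ Sel^{S}` (`selmerAc_empty_le`), so
the `p`-torsion of `Sel^∅` is finite too, and criterion (A) applies at `∅`. This is the input v11's
`stub_muSelmer` consumes (cf. p622336 `isTorsion_muInvariant_eq_zero_empty_of_imprimitive`, which reaches
the same conclusion from torsion + `μ = 0` of `X^{S}` through the `λ`-shift).
[cite: GreenbergLNM1716, §1 p. 60] [cite: GreenbergVatsal2000, §2 Prop. (2.8)] [cite: Castella2018, Def. 2.2] -/
theorem isTorsion_muInvariant_eq_zero_empty_of_residualFinite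
    {K : Type} [Field K] [NumberField K] {p : ℕ} [Fact p.Prime]
    (W : WeierstrassCurve K) [W.IsElliptic] (κ : ZpExtension K p) (𝔭 : HeightOneSpectrum (𝓞 K))
    (γ : absoluteGaloisGroup K) [Fact (κ.IsTopGenerator γ)] (S : Set (HeightOneSpectrum (𝓞 K)))
    (hfin : Set.Finite {s : selmerAc W p κ 𝔭 S | p • s = 0}) :
    Module.IsTorsion (IwasawaAlgebra p) (XAc W p κ 𝔭 ∅ γ) ∧ muInvariant p (XAc W p κ 𝔭 ∅ γ) = 0 := by
  -- the `p`-torsion of `Sel^∅` embeds into that of `Sel^S` along the inclusion homomorphism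
  have hfin₀ : Set.Finite {s : selmerAc W p κ 𝔭 ∅ | p • s = 0} := by
    let ι : selmerAc W p κ 𝔭 (∅ : Set (HeightOneSpectrum (𝓞 K))) →+ selmerAc W p κ 𝔭 S :=
      AddSubgroup.inclusion selmerAc_empty_le
    have hι : Function.Injective ι := AddSubgroup.inclusion_injective selmerAc_empty_le
    refine Set.Finite.of_finite_image ?_ hι.injOn
    refine hfin.subset ?_
    rintro _ ⟨s, hs, rfl⟩
    have hs' : p • s = 0 := hs
    show p • ι s = 0
    rw [← map_nsmul, hs', map_zero]
  exact ⟨UniversalToricDescentAcDualMuZero.isTorsion_of_finite_pTorsion W p κ 𝔭 ∅ γ Set.finite_empty hfin₀,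
    UniversalToricDescentAcDualMuZero.muInvariant_eq_zero_of_finite_pTorsion W p κ 𝔭 ∅ γ Set.finite_empty
      hfin₀⟩

end Summit.BirchSwinnertonDyer.BirchSwinnertonDyer.Theorems.KellerYinLemma511ResidualFinite

end
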